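import Summits.CriticalPhenomena.PercolationContinuityZ3.Theorems.PercNearOneGluingNoHeavyLowerTailSahiE3ExchangeCross
import Mathlib.Tactic.Linarith
import Mathlib.Tactic.Ring
import Mathlib.Tactic.Positivity
import HarnessLib
import HarnessLib.Audit

/-!
# `NoHeavyLowerTail` (crux stmt-CriticalPhenomena-4575), Sahi programme P4: OR-peel of the flagship — level `z₂`, the Bernstein coefficient `c₁(D₂)`, generic (crossing-free) branch

Support file (cell `prim-l12`, seat P4, generation 24; `--supports stmt-CriticalPhenomena-4575`).  No named facts, no sorries;
standard axioms; def-free.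

Companion of `…SahiE3LevelZ2C2Generic` / `…SahiE3LevelZ2E2Generic` (HOME prim-l12-p4/FROM-prim-l12-p4-gen24-LEVEL-Z2-STRUCTURE.md).
At level `(Q',G') = (Bool_{z₂}, {z₂})` of the OR-peel, `D₂` is a cubic in `p₂` whose Bernstein coefficients `c₃..c₀` are functions
of a pair of two-column configurations `O^t ⊆ K^t, L^t ⊆ P^t`, `X⁰ ⊆ X¹` of up-sets of a Harris block `(B,w,V)` and of the certificate
`R` of `V`; `c₀ = EXCH₂(C⁰;C'⁰)` is the level-`∅` exchange expression of the column-0 configurations.  This file proves, for an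
ARBITRARY block, the generic branch of `c₁(D₂) ≥ 0`: the exact identity `c₁(D₂) = EXCH₂(C⁰;C'⁰) + [two pair slacks of the unit
Σ = (K⁰,L¹;K'⁰,L'¹)] + [ten Harris slacks] + (1−v)·[twelve products of nested mass differences] + [pointwise sums]` holds, the
pointwise sums being nonnegative when `V` has no crossing point of the kinds `Σ = (K⁰∖L¹)(L'¹∖K'⁰)`, `Σ̃ = (K¹∖L⁰)(L'⁰∖K'¹)`,
`corner = (P⁰∖O¹)(O'¹∖P'⁰)` (and mirrors).  THEOREM `c1_ge_exch_of_noCross`: under these hypotheses `EXCH₂(C⁰;C'⁰) ≤ c₁(D₂)`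
(so `c₁(D₂) ≥ 0` by the level-`∅` theorem for `(C⁰,C'⁰)`).  Certificate found by an LP over pointwise certificates and verified in
exact arithmetic (HOME lab/plp*.py).
-/

namespace Summit.CriticalPhenomena.PercolationContinuityZ3.Theorems.SahiE3LevelZ2C1Generic

open Finset SahiE3ExchangeCross
open scoped BigOperators

variable {B : Type*} [DecidableEq B]

/-- **Level `z₂`, coefficient `c₁(D₂)`, generic branch** (see the module docstring): finite block, weight `w ≥ 0` of mass `1`,
slot `V`, `R ≥ 0` on `V` with the pair inequality at `(K⁰,L'¹)` and `(L¹,K'⁰)`, two-column configurations with the listed nestings,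
ten Harris inequalities, no crossing point of the kinds Σ̃, corner, Σ: the level-`∅` exchange expression of the column-0 pair is at most `c₁(D₂)`. [this work] -/
theorem c1_ge_exch_of_noCross [Fintype B] (w R : B → ℝ) (hw : ∀ b, 0 ≤ w b) (hw1 : ∑ b, w b = 1)
    (V P₀ K₀ L₀ O₀ P₁ K₁ L₁ O₁ P₀' K₀' L₀' O₀' P₁' K₁' L₁' O₁' : Finset B) (hR : ∀ b ∈ V, 0 ≤ R b)
    (h_O0_K0 : O₀ ⊆ K₀) (h_K0_K1 : K₀ ⊆ K₁) (h_O0_P0 : O₀ ⊆ P₀) (h_O0_P1 : O₀ ⊆ P₁) (h_P0_P1 : P₀ ⊆ P₁) (h_K1_P1 : K₁ ⊆ P₁) (h_L1_P1 : L₁ ⊆ P₁) (h_O0p_K0p : O₀' ⊆ K₀') (h_K0p_K1p : K₀' ⊆ K₁') (h_O0p_P0p : O₀' ⊆ P₀') (h_O0p_P1p : O₀' ⊆ P₁') (h_P0p_P1p : P₀' ⊆ P₁') (h_K1p_P1p : K₁' ⊆ P₁') (h_L1p_P1p : L₁' ⊆ P₁') (h_K0p_P0p : K₀' ⊆ P₀')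 (h_L0_P0 : L₀ ⊆ P₀) (h_L0p_L1p : L₀' ⊆ L₁')
    (hΞ1a : ((K₁ \ L₀) ∩ (L₀' \ K₁')) ∩ V = ∅) (hΞ1b : ((L₀ \ K₁) ∩ (K₁' \ L₀')) ∩ V = ∅)
    (hΞ2a : ((P₀ \ O₁) ∩ (O₁' \ P₀')) ∩ V = ∅) (hΞ2b : ((O₁ \ P₀) ∩ (P₀' \ O₁')) ∩ V = ∅)
    (hΞ3a : ((K₀ \ L₁) ∩ (L₁' \ K₀')) ∩ V = ∅) (hΞ3b : ((L₁ \ K₀) ∩ (K₀' \ L₁')) ∩ V = ∅)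
    (hH1 : (∑ b ∈ K₁, w b) * (∑ b ∈ K₁', w b) ≤ (∑ b ∈ K₁ ∩ K₁', w b))
    (hH2 : (∑ b ∈ K₁, w b) * (∑ b ∈ L₀' ∩ V, w b) ≤ (∑ b ∈ (K₁ ∩ L₀') ∩ V, w b))
    (hH3 : (∑ b ∈ K₁', w b) * (∑ b ∈ L₀ ∩ V, w b) ≤ (∑ b ∈ (L₀ ∩ K₁') ∩ V, w b))
    (hH4 : (∑ b ∈ P₀, w b) * (∑ b ∈ O₀' ∩ V, w b) ≤ (∑ b ∈ (P₀ ∩ O₀') ∩ V, w b))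
    (hH5 : (∑ b ∈ P₀, w b) * (∑ b ∈ O₁' ∩ V, w b) ≤ (∑ b ∈ (P₀ ∩ O₁') ∩ V, w b))
    (hH6 : (∑ b ∈ P₀', w b) * (∑ b ∈ O₀ ∩ V, w b) ≤ (∑ b ∈ (O₀ ∩ P₀') ∩ V, w b))
    (hH7 : (∑ b ∈ P₀', w b) * (∑ b ∈ O₁ ∩ V, w b) ≤ (∑ b ∈ (O₁ ∩ P₀') ∩ V, w b))
    (hH8 : (∑ b ∈ P₁, w b) * (∑ b ∈ O₀' ∩ V, w b) ≤ (∑ b ∈ (P₁ ∩ O₀') ∩ V, w b))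
    (hH9 : (∑ b ∈ P₁, w b) * (∑ b ∈ P₁', w b) ≤ (∑ b ∈ P₁ ∩ P₁', w b))
    (hH10 : (∑ b ∈ P₁', w b) * (∑ b ∈ O₀ ∩ V, w b) ≤ (∑ b ∈ (O₀ ∩ P₁') ∩ V, w b))
    (hH11 : ((∑ b ∈ K₀, w b) * (∑ b ∈ L₁' ∩ V, w b) + (∑ b ∈ L₁', w b) * (∑ b ∈ K₀ ∩ V, w b) - (∑ b ∈ V, w b) * (∑ b ∈ K₀, w b) * (∑ b ∈ L₁', w b)) ≤ (∑ b ∈ (K₀ ∩ L₁') ∩ V, R b))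
    (hH12 : ((∑ b ∈ L₁, w b) * (∑ b ∈ K₀' ∩ V, w b) + (∑ b ∈ K₀', w b) * (∑ b ∈ L₁ ∩ V, w b) - (∑ b ∈ V, w b) * (∑ b ∈ L₁, w b) * (∑ b ∈ K₀', w b)) ≤ (∑ b ∈ (L₁ ∩ K₀') ∩ V, R b)) :
    (∑ b ∈ V, w b)*(∑ b ∈ L₀, w b)*(∑ b ∈ P₀', w b) + (∑ b ∈ V, w b)*(∑ b ∈ K₀, w b)*(∑ b ∈ P₀', w b) + (∑ b ∈ V, w b)*(∑ b ∈ P₀, w b)*(∑ b ∈ L₀', w b) + (∑ b ∈ V, w b)*(∑ b ∈ P₀, w b)*(∑ b ∈ K₀', w b) - ((∑ b ∈ V, w b)*(∑ b ∈ P₀, w b)*(∑ b ∈ P₀', w b)) - ((∑ b ∈ O₀ ∩ V, w b)*(∑ b ∈ P₀', w b)) - ((∑ b ∈ L₀ ∩ V, w b)*(∑ b ∈ K₀', w b)) - ((∑ b ∈ L₀, w b)*(∑ b ∈ K₀' ∩ V, w b)) + (∑ b ∈ L₀, w b)*(∑ b ∈ K₀', w b) - ((∑ b ∈ L₀, w b)*(∑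 b ∈ P₀', w b)) - ((∑ b ∈ K₀ ∩ V, w b)*(∑ b ∈ L₀', w b)) - ((∑ b ∈ K₀, w b)*(∑ b ∈ L₀' ∩ V, w b)) + (∑ b ∈ K₀, w b)*(∑ b ∈ L₀', w b) - ((∑ b ∈ K₀, w b)*(∑ b ∈ P₀', w b)) - ((∑ b ∈ P₀, w b)*(∑ b ∈ O₀' ∩ V, w b)) - ((∑ b ∈ P₀, w b)*(∑ b ∈ L₀', w b)) - ((∑ b ∈ P₀, w b)*(∑ b ∈ K₀', w b)) + (∑ b ∈ P₀, w b)*(∑ b ∈ P₀', w b) - ((∑ b ∈ V, w b)*(∑ b ∈ P₀ ∩ P₀', w b)) + (∑ b ∈ (O₀ ∩ O₀') ∩ V, w b) + (∑ b ∈ (L₀ ∩ L₀') ∩ V, R b) + (∑ b ∈ (K₀ ∩ K₀') ∩ V, R b) + (∑ b ∈ P₀ ∩ P₀', w b) + (∑ b ∈ (P₀ ∩ P₀') ∩ V, w b)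
      ≤ (∑ b ∈ V, w b)*(∑ b ∈ L₁, w b)*(∑ b ∈ P₀', w b) + (∑ b ∈ V, w b)*(∑ b ∈ L₀, w b)*(∑ b ∈ P₁', w b) + (∑ b ∈ V, w b)*(∑ b ∈ K₁, w b)*(∑ b ∈ P₀', w b) + (∑ b ∈ V, w b)*(∑ b ∈ K₀, w b)*(∑ b ∈ P₁', w b) + (∑ b ∈ V, w b)*(∑ b ∈ K₀, w b)*(∑ b ∈ P₀', w b) + (∑ b ∈ V, w b)*(∑ b ∈ P₁, w b)*(∑ b ∈ L₀', w b) + (∑ b ∈ V, w b)*(∑ b ∈ P₁, w b)*(∑ b ∈ K₀', w b) - ((∑ b ∈ V, w b)*(∑ b ∈ P₁, w b)*(∑ b ∈ P₀', w b)) + (∑ b ∈ V, w b)*(∑ b ∈ P₀, w b)*(∑ b ∈ L₁', w b) + (∑ b ∈ V, w b)*(∑ b ∈ P₀, w b)*(∑ b ∈ K₁', w b) + (∑ b ∈ V, w b)*(∑ b ∈ P₀, w b)*(∑ b ∈ K₀', w b) - ((∑ b ∈ V, w b)*(∑ b ∈ P₀, w b)*(∑ b ∈ P₁', w b)) - ((∑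 b ∈ O₁ ∩ V, w b)*(∑ b ∈ P₀', w b)) - ((∑ b ∈ O₀ ∩ V, w b)*(∑ b ∈ P₁', w b)) - ((∑ b ∈ O₀ ∩ V, w b)*(∑ b ∈ P₀', w b)) - ((∑ b ∈ L₁ ∩ V, w b)*(∑ b ∈ K₀', w b)) - ((∑ b ∈ L₁, w b)*(∑ b ∈ K₀' ∩ V, w b)) + (∑ b ∈ L₁, w b)*(∑ b ∈ K₀', w b) - ((∑ b ∈ L₁, w b)*(∑ b ∈ P₀', w b)) - ((∑ b ∈ L₀ ∩ V, w b)*(∑ b ∈ K₁', w b)) - ((∑ b ∈ L₀ ∩ V, w b)*(∑ b ∈ K₀', w b)) - ((∑ b ∈ L₀, w b)*(∑ b ∈ K₀' ∩ V, w b)) + (∑ b ∈ L₀, w b)*(∑ b ∈ K₀', w b) - ((∑ b ∈ L₀, w b)*(∑ b ∈ P₁', w b)) - ((∑ b ∈ K₁, w b)*(∑ b ∈ L₀' ∩ V, w b)) - ((∑ b ∈ K₁, w b)*(∑ b ∈ P₀', w b)) - ((∑ b ∈ K₀ ∩ V, w b)*(∑ b ∈ L₁', w b)) - ((∑ b ∈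 K₀ ∩ V, w b)*(∑ b ∈ L₀', w b)) - ((∑ b ∈ K₀, w b)*(∑ b ∈ L₁' ∩ V, w b)) + (∑ b ∈ K₀, w b)*(∑ b ∈ L₁', w b) - ((∑ b ∈ K₀, w b)*(∑ b ∈ L₀' ∩ V, w b)) + (∑ b ∈ K₀, w b)*(∑ b ∈ L₀', w b) - ((∑ b ∈ K₀, w b)*(∑ b ∈ P₁', w b)) - ((∑ b ∈ K₀, w b)*(∑ b ∈ P₀', w b)) - ((∑ b ∈ P₁, w b)*(∑ b ∈ O₀' ∩ V, w b)) - ((∑ b ∈ P₁, w b)*(∑ b ∈ L₀', w b)) - ((∑ b ∈ P₁, w b)*(∑ b ∈ K₀', w b)) + (∑ b ∈ P₁, w b)*(∑ b ∈ P₀', w b) - ((∑ b ∈ P₀, w b)*(∑ b ∈ O₁' ∩ V, w b)) - ((∑ b ∈ P₀, w b)*(∑ b ∈ O₀' ∩ V, w b)) - ((∑ b ∈ P₀, w b)*(∑ b ∈ L₁', w b)) - ((∑ b ∈ P₀, w b)*(∑ b ∈ K₁', w b)) - ((∑ b ∈ P₀, w b)*(∑ b ∈ K₀', w b)) + (∑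 b ∈ P₀, w b)*(∑ b ∈ P₁', w b) - ((∑ b ∈ V, w b)*(∑ b ∈ K₁ ∩ K₁', w b)) - ((∑ b ∈ V, w b)*(∑ b ∈ P₁ ∩ P₁', w b)) + (-2 : ℝ)*(∑ b ∈ V, w b)*(∑ b ∈ P₀ ∩ P₀', w b) + (∑ b ∈ (O₁ ∩ O₁') ∩ V, w b) + (2 : ℝ)*(∑ b ∈ (O₀ ∩ O₀') ∩ V, w b) + (∑ b ∈ (L₁ ∩ L₁') ∩ V, R b) + (∑ b ∈ (L₀ ∩ L₀') ∩ V, R b) + (∑ b ∈ (L₀ ∩ L₀') ∩ V, w b) + (2 : ℝ)*(∑ b ∈ (K₀ ∩ K₀') ∩ V, R b) + (∑ b ∈ K₁ ∩ K₁', w b) + (∑ b ∈ (K₁ ∩ K₁') ∩ V, w b) + (2 : ℝ)*(∑ b ∈ P₁ ∩ P₁', w b) + (∑ b ∈ P₀ ∩ P₀', w b) + (3 : ℝ)*(∑ b ∈ (P₀ ∩ P₀') ∩ V, w b) := by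
  have hwV : ∀ b ∈ V, 0 ≤ w b := fun b _ => hw b
  have hv0 : 0 ≤ ∑ b ∈ V, w b := Finset.sum_nonneg fun b _ => hw b
  have hv1 : ∑ b ∈ V, w b ≤ 1 := by rw [← hw1]; exact sum_le_sum_of_subset' w hw (Finset.subset_univ V)
  have hx1 := cross_le_same_of_noCross w V K₁ L₀ K₁' L₀' hwV hΞ1a hΞ1b
  have hx2 := cross_le_same_of_noCross w V P₀ O₁ P₀' O₁' hwV hΞ2a hΞ2b
  have hmd1 := modularity_nested w V P₀ O₀ P₀' O₀' hwV h_O0_P0 h_O0p_P0p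
  have hmd2 := modularity_nested w V P₁ O₀ P₁' O₀' hwV h_O0_P1 h_O0p_P1p
  have hc1 : (∑ b ∈ P₀ ∩ P₀', w b) - (∑ b ∈ (P₀ ∩ P₀') ∩ V, w b) ≤ (∑ b ∈ P₁ ∩ P₁', w b) - (∑ b ∈ (P₁ ∩ P₁') ∩ V, w b) := by
    have key : ∀ X Y : Finset B, X ⊆ Y → (∑ b ∈ X, w b) - (∑ b ∈ X ∩ V, w b) ≤ (∑ b ∈ Y, w b) - (∑ b ∈ Y ∩ V, w b) := by
      intro X Y h
      have hX := Finset.sum_sdiff (f := w) (Finset.inter_subset_left (s₁ := X) (s₂ := V))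
      have hY := Finset.sum_sdiff (f := w) (Finset.inter_subset_left (s₁ := Y) (s₂ := V))
      have hsub : X \ (X ∩ V) ⊆ Y \ (Y ∩ V) := by
        intro b hb
        rw [Finset.mem_sdiff, Finset.mem_inter] at hb ⊢
        exact ⟨h hb.1, fun hh => hb.2 ⟨hb.1, hh.2⟩⟩
      have := Finset.sum_le_sum_of_subset_of_nonneg hsub (f := w) (fun b _ _ => hw b)
      linarith
    exact key _ _ (Finset.inter_subset_inter h_P0_P1 h_P0p_P1p)
  have hr1 := cross_le_same_of_noCross R V K₀ L₁ K₀' L₁' hR hΞ3a hΞ3b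
  have e1 : 0 ≤ (1 - (∑ b ∈ V, w b)) * ((∑ b ∈ K₁ ∩ K₁', w b) - (∑ b ∈ K₁, w b) * (∑ b ∈ K₁', w b)) := mul_nonneg (by linarith) (by linarith [hH1])
  have e2 : 0 ≤ (1 - (∑ b ∈ V, w b)) * ((∑ b ∈ (P₀ ∩ O₀') ∩ V, w b) - (∑ b ∈ P₀, w b) * (∑ b ∈ O₀' ∩ V, w b)) := mul_nonneg (by linarith) (by linarith [hH4])
  have e3 : 0 ≤ (1 - (∑ b ∈ V, w b)) * ((∑ b ∈ (O₀ ∩ P₀') ∩ V, w b) - (∑ b ∈ P₀', w b) * (∑ b ∈ O₀ ∩ V, w b)) := mul_nonneg (by linarith) (by linarith [hH6])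
  have e4 : 0 ≤ (∑ b ∈ V, w b) * ((∑ b ∈ (P₁ ∩ O₀') ∩ V, w b) - (∑ b ∈ P₁, w b) * (∑ b ∈ O₀' ∩ V, w b)) := mul_nonneg hv0 (by linarith [hH8])
  have e5 : 0 ≤ (1 - (∑ b ∈ V, w b)) * ((∑ b ∈ P₁ ∩ P₁', w b) - (∑ b ∈ P₁, w b) * (∑ b ∈ P₁', w b)) := mul_nonneg (by linarith) (by linarith [hH9])
  have e6 : 0 ≤ (∑ b ∈ V, w b) * ((∑ b ∈ (O₀ ∩ P₁') ∩ V, w b) - (∑ b ∈ P₁', w b) * (∑ b ∈ O₀ ∩ V, w b)) := mul_nonneg hv0 (by linarith [hH10])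
  have hm_O0_K0 : (∑ b ∈ O₀, w b) ≤ (∑ b ∈ K₀, w b) := sum_le_sum_of_subset' w hw (h_O0_K0)
  have hm_P0p_P1p : (∑ b ∈ P₀', w b) ≤ (∑ b ∈ P₁', w b) := sum_le_sum_of_subset' w hw (h_P0p_P1p)
  have e7 : 0 ≤ (1 - (∑ b ∈ V, w b)) * (((∑ b ∈ K₀, w b) - (∑ b ∈ O₀, w b)) * ((∑ b ∈ P₁', w b) - (∑ b ∈ P₀', w b))) := mul_nonneg (by linarith) (mul_nonneg (by linarith [hm_O0_K0]) (by linarith [hm_P0p_P1p]))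
  have hm_K0_K1 : (∑ b ∈ K₀, w b) ≤ (∑ b ∈ K₁, w b) := sum_le_sum_of_subset' w hw (h_K0_K1)
  have hm_L1p_P1p : (∑ b ∈ L₁', w b) ≤ (∑ b ∈ P₁', w b) := sum_le_sum_of_subset' w hw (h_L1p_P1p)
  have e8 : 0 ≤ (1 - (∑ b ∈ V, w b)) * (((∑ b ∈ K₁, w b) - (∑ b ∈ K₀, w b)) * ((∑ b ∈ P₁', w b) - (∑ b ∈ L₁', w b))) := mul_nonneg (by linarith) (mul_nonneg (by linarith [hm_K0_K1]) (by linarith [hm_L1p_P1p]))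
  have e9 : 0 ≤ (1 - (∑ b ∈ V, w b)) * (((∑ b ∈ K₁, w b) - (∑ b ∈ K₀, w b)) * ((∑ b ∈ P₁', w b) - (∑ b ∈ P₀', w b))) := mul_nonneg (by linarith) (mul_nonneg (by linarith [hm_K0_K1]) (by linarith [hm_P0p_P1p]))
  have hm_O0_V_O0 : (∑ b ∈ O₀ ∩ V, w b) ≤ (∑ b ∈ O₀, w b) := sum_le_sum_of_subset' w hw (by intro b hb; simp only [Finset.mem_inter] at hb ⊢; tauto)
  have e10 : 0 ≤ (1 - (∑ b ∈ V, w b)) * (((∑ b ∈ O₀, w b) - (∑ b ∈ O₀ ∩ V, w b)) * ((∑ b ∈ P₁', w b) - (∑ b ∈ P₀', w b))) := mul_nonneg (by linarith) (mul_nonneg (by linarith [hm_O0_V_O0]) (by linarith [hm_P0p_P1p]))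
  have hm_L0_P0 : (∑ b ∈ L₀, w b) ≤ (∑ b ∈ P₀, w b) := sum_le_sum_of_subset' w hw (h_L0_P0)
  have e11 : 0 ≤ (1 - (∑ b ∈ V, w b)) * (((∑ b ∈ P₀, w b) - (∑ b ∈ L₀, w b)) * ((∑ b ∈ P₁', w b) - (∑ b ∈ P₀', w b))) := mul_nonneg (by linarith) (mul_nonneg (by linarith [hm_L0_P0]) (by linarith [hm_P0p_P1p]))
  have hm_K1_P1 : (∑ b ∈ K₁, w b) ≤ (∑ b ∈ P₁, w b) := sum_le_sum_of_subset' w hw (h_K1_P1)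
  have hm_K1p_P1p : (∑ b ∈ K₁', w b) ≤ (∑ b ∈ P₁', w b) := sum_le_sum_of_subset' w hw (h_K1p_P1p)
  have e12 : 0 ≤ (1 - (∑ b ∈ V, w b)) * (((∑ b ∈ P₁, w b) - (∑ b ∈ K₁, w b)) * ((∑ b ∈ P₁', w b) - (∑ b ∈ K₁', w b))) := mul_nonneg (by linarith) (mul_nonneg (by linarith [hm_K1_P1]) (by linarith [hm_K1p_P1p]))
  have e13 : 0 ≤ (1 - (∑ b ∈ V, w b)) * (((∑ b ∈ P₁, w b) - (∑ b ∈ K₁, w b)) * ((∑ b ∈ P₁', w b) - (∑ b ∈ L₁', w b))) := mul_nonneg (by linarith) (mul_nonneg (by linarith [hm_K1_P1]) (by linarith [hm_L1p_P1p]))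
  have hm_L1_P1 : (∑ b ∈ L₁, w b) ≤ (∑ b ∈ P₁, w b) := sum_le_sum_of_subset' w hw (h_L1_P1)
  have hm_K0p_P0p : (∑ b ∈ K₀', w b) ≤ (∑ b ∈ P₀', w b) := sum_le_sum_of_subset' w hw (h_K0p_P0p)
  have e14 : 0 ≤ (1 - (∑ b ∈ V, w b)) * (((∑ b ∈ P₁, w b) - (∑ b ∈ L₁, w b)) * ((∑ b ∈ P₀', w b) - (∑ b ∈ K₀', w b))) := mul_nonneg (by linarith) (mul_nonneg (by linarith [hm_L1_P1]) (by linarith [hm_K0p_P0p]))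
  have hm_P0_P1 : (∑ b ∈ P₀, w b) ≤ (∑ b ∈ P₁, w b) := sum_le_sum_of_subset' w hw (h_P0_P1)
  have hm_O0p_K0p : (∑ b ∈ O₀', w b) ≤ (∑ b ∈ K₀', w b) := sum_le_sum_of_subset' w hw (h_O0p_K0p)
  have e15 : 0 ≤ (1 - (∑ b ∈ V, w b)) * (((∑ b ∈ P₁, w b) - (∑ b ∈ P₀, w b)) * ((∑ b ∈ K₀', w b) - (∑ b ∈ O₀', w b))) := mul_nonneg (by linarith) (mul_nonneg (by linarith [hm_P0_P1]) (by linarith [hm_O0p_K0p]))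
  have hm_K0p_K1p : (∑ b ∈ K₀', w b) ≤ (∑ b ∈ K₁', w b) := sum_le_sum_of_subset' w hw (h_K0p_K1p)
  have e16 : 0 ≤ (1 - (∑ b ∈ V, w b)) * (((∑ b ∈ P₁, w b) - (∑ b ∈ P₀, w b)) * ((∑ b ∈ K₁', w b) - (∑ b ∈ K₀', w b))) := mul_nonneg (by linarith) (mul_nonneg (by linarith [hm_P0_P1]) (by linarith [hm_K0p_K1p]))
  have hm_L0p_L1p : (∑ b ∈ L₀', w b) ≤ (∑ b ∈ L₁', w b) := sum_le_sum_of_subset' w hw (h_L0p_L1p)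
  have e17 : 0 ≤ (1 - (∑ b ∈ V, w b)) * (((∑ b ∈ P₁, w b) - (∑ b ∈ P₀, w b)) * ((∑ b ∈ L₁', w b) - (∑ b ∈ L₀', w b))) := mul_nonneg (by linarith) (mul_nonneg (by linarith [hm_P0_P1]) (by linarith [hm_L0p_L1p]))
  have hm_O0p_V_O0p : (∑ b ∈ O₀' ∩ V, w b) ≤ (∑ b ∈ O₀', w b) := sum_le_sum_of_subset' w hw (by intro b hb; simp only [Finset.mem_inter] at hb ⊢; tauto)
  have e18 : 0 ≤ (1 - (∑ b ∈ V, w b)) * (((∑ b ∈ P₁, w b) - (∑ b ∈ P₀, w b)) * ((∑ b ∈ O₀', w b) - (∑ b ∈ O₀' ∩ V, w b))) := mul_nonneg (by linarith) (mul_nonneg (by linarith [hm_P0_P1]) (by linarith [hm_O0p_V_O0p]))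
  have e19 : 0 ≤ (1 - (∑ b ∈ V, w b)) * ((∑ b ∈ (K₁ ∩ K₁') ∩ V, w b) + (∑ b ∈ (L₀ ∩ L₀') ∩ V, w b) - (∑ b ∈ (K₁ ∩ L₀') ∩ V, w b) - (∑ b ∈ (L₀ ∩ K₁') ∩ V, w b)) := mul_nonneg (by linarith) (by linarith [hx1])
  have e20 : 0 ≤ (∑ b ∈ V, w b) * ((∑ b ∈ (K₁ ∩ K₁') ∩ V, w b) + (∑ b ∈ (L₀ ∩ L₀') ∩ V, w b) - (∑ b ∈ (K₁ ∩ L₀') ∩ V, w b) - (∑ b ∈ (L₀ ∩ K₁') ∩ V, w b)) := mul_nonneg hv0 (by linarith [hx1])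
  have e21 : 0 ≤ (1 - (∑ b ∈ V, w b)) * ((∑ b ∈ (P₀ ∩ P₀') ∩ V, w b) + (∑ b ∈ (O₁ ∩ O₁') ∩ V, w b) - (∑ b ∈ (P₀ ∩ O₁') ∩ V, w b) - (∑ b ∈ (O₁ ∩ P₀') ∩ V, w b)) := mul_nonneg (by linarith) (by linarith [hx2])
  have e22 : 0 ≤ (∑ b ∈ V, w b) * ((∑ b ∈ (P₀ ∩ P₀') ∩ V, w b) + (∑ b ∈ (O₁ ∩ O₁') ∩ V, w b) - (∑ b ∈ (P₀ ∩ O₁') ∩ V, w b) - (∑ b ∈ (O₁ ∩ P₀') ∩ V, w b)) := mul_nonneg hv0 (by linarith [hx2])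
  have e23 : 0 ≤ (1 - (∑ b ∈ V, w b)) * ((∑ b ∈ (P₀ ∩ P₀') ∩ V, w b) + (∑ b ∈ (O₀ ∩ O₀') ∩ V, w b) - (∑ b ∈ (P₀ ∩ O₀') ∩ V, w b) - (∑ b ∈ (O₀ ∩ P₀') ∩ V, w b)) := mul_nonneg (by linarith) (by linarith [hmd1])
  have e24 : 0 ≤ (∑ b ∈ V, w b) * ((∑ b ∈ (P₀ ∩ P₀') ∩ V, w b) + (∑ b ∈ (O₀ ∩ O₀') ∩ V, w b) - (∑ b ∈ (P₀ ∩ O₀') ∩ V, w b) - (∑ b ∈ (O₀ ∩ P₀') ∩ V, w b)) := mul_nonneg hv0 (by linarith [hmd1])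
  have e25 : 0 ≤ (1 - (∑ b ∈ V, w b)) * ((∑ b ∈ (P₁ ∩ P₁') ∩ V, w b) + (∑ b ∈ (O₀ ∩ O₀') ∩ V, w b) - (∑ b ∈ (P₁ ∩ O₀') ∩ V, w b) - (∑ b ∈ (O₀ ∩ P₁') ∩ V, w b)) := mul_nonneg (by linarith) (by linarith [hmd2])
  have e26 : 0 ≤ (∑ b ∈ V, w b) * ((∑ b ∈ (P₁ ∩ P₁') ∩ V, w b) + (∑ b ∈ (O₀ ∩ O₀') ∩ V, w b) - (∑ b ∈ (P₁ ∩ O₀') ∩ V, w b) - (∑ b ∈ (O₀ ∩ P₁') ∩ V, w b)) := mul_nonneg hv0 (by linarith [hmd2])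
  have e27 : 0 ≤ (1 - (∑ b ∈ V, w b)) * (((∑ b ∈ P₁ ∩ P₁', w b) - (∑ b ∈ (P₁ ∩ P₁') ∩ V, w b)) - ((∑ b ∈ P₀ ∩ P₀', w b) - (∑ b ∈ (P₀ ∩ P₀') ∩ V, w b))) := mul_nonneg (by linarith) (by linarith [hc1])
  have e28 : 0 ≤ (∑ b ∈ V, w b) * (((∑ b ∈ P₁ ∩ P₁', w b) - (∑ b ∈ (P₁ ∩ P₁') ∩ V, w b)) - ((∑ b ∈ P₀ ∩ P₀', w b) - (∑ b ∈ (P₀ ∩ P₀') ∩ V, w b))) := mul_nonneg hv0 (by linarith [hc1])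
  linarith [hH1, hH2, hH3, hH4, hH5, hH6, hH7, hH8, hH9, hH10, hH11, hH12, hx1, hx2, hmd1, hmd2, hc1, hr1, e1, e2, e3, e4, e5, e6, e7, e8, e9, e10, e11, e12, e13, e14, e15, e16, e17, e18, e19, e20, e21, e22, e23, e24, e25, e26, e27, e28]

end Summit.CriticalPhenomena.PercolationContinuityZ3.Theorems.SahiE3LevelZ2C1Generic
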